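import Mathlib
import HarnessLib

/-!
# ζ(5) search — Families: the METHOD OF TYPES for coefficients of powers of a polynomial with non-negative coefficients (p3 g8)

HONEST FRAMING: systematic search; no irrationality claim unless certified.  Pure algebra / elementary analysis;
nothing in this file mentions a zeta value and no number of record moves.

OUR work (Summit side; cell `pub-zeta5`, prover seat p3, generation 8).  General lemmas for the `liminf` half of the
cell's CONJECTURE D (`Families/DualConstantTerm.LeadingCoeffRateIsDualDecay`: the growth rate of Brown–Zudilin's leading
coefficients `|Q(n·a)| = CT[Λ_aⁿ]` — D-exact, `Families/DualExactFullCone` — equals `log min Λ_a`).  For an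
`MvPolynomial` `N = Σ_k c_k X^k` over `ℝ` with support `s`:

* `pow_eq_sum_types` — the MULTINOMIAL EXPANSION BY TYPES: `Nⁿ = Σ_{t ∈ s.piAntidiag n} monomial (Σ_k t_k•k) (multinomial(t)·∏ c_k^{t_k})`
  (Mathlib's `Finset.sum_pow_eq_sum_piAntidiag`), hence `coeff_pow_eq_sum_types`;
* for NON-NEGATIVE coefficients: `tweight_le_coeff_pow` (ONE type bounds the coefficient from below), `coeff_pow_nonneg`,
  `coeff_mul_supermul` / `coeff_pow_supermul` (super-multiplicativity `coeff e (Nⁿ)·coeff e' (Nᵐ) ≤ coeff (e+e') (Nⁿ⁺ᵐ)`),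
  and the trivial upper bound `coeff_pow_mul_monomial_le` (`coeff e (Nⁿ)·gᵉ ≤ N(g)ⁿ` for `g ≥ 0`);
* the STIRLING entropy bound for multinomial coefficients `log_multinomial_ge`:
  `Σ_k t_k log(n/t_k) − |s|·(1 + log n/2) ≤ log multinomial(t)` (`n = Σ t_k ≥ 1`), from Mathlib's
  `Stirling.le_factorial_stirling` and the monotonicity of `Stirling.stirlingSeq`.

The assembly (tilted measure at a critical point, rounding types, bounded defects) is the sequel file
`ConstantTermTypesLimit`.  Standard axioms only.
-/

noncomputable section

open MvPolynomial Finset Real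

namespace Summit.KontsevichZagierPeriods.Zeta5Search.Families.CTTypes

variable {σ : Type*} [DecidableEq σ]

/-! ## Types: exponent and weight -/

/-- The exponent `Σ_{k ∈ s} t_k • k` of a type `t` on the monomial set `s`. -/
def texp (s : Finset (σ →₀ ℕ)) (t : (σ →₀ ℕ) → ℕ) : σ →₀ ℕ := ∑ k ∈ s, t k • k

/-- The weight `multinomial(t) · ∏_{k ∈ s} c_k^{t_k}` of a type `t` for the polynomial `N` (`c_k = coeff k N`). -/
def tweight (N : MvPolynomial σ ℝ) (s : Finset (σ →₀ ℕ)) (t : (σ →₀ ℕ) → ℕ) : ℝ :=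
  (Nat.multinomial s t : ℝ) * ∏ k ∈ s, N.coeff k ^ t k

/-- **Multinomial expansion by types**: `Nⁿ = Σ_{t ∈ s.piAntidiag n} monomial (texp s t) (tweight N s t)` for any
finset `s ⊇ support N` written as `N = Σ_{k∈s} monomial k (coeff k N)`. -/
theorem sum_monomial_pow_eq_sum_types (N : MvPolynomial σ ℝ) (s : Finset (σ →₀ ℕ)) (n : ℕ) :
    (∑ k ∈ s, monomial k (N.coeff k)) ^ n = ∑ t ∈ s.piAntidiag n, monomial (texp s t) (tweight N s t) := by
  rw [Finset.sum_pow_eq_sum_piAntidiag]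
  refine Finset.sum_congr rfl fun t _ => ?_
  have h1 : ∏ k ∈ s, (monomial k (N.coeff k)) ^ t k = monomial (texp s t) (∏ k ∈ s, N.coeff k ^ t k) := by
    rw [texp, monomial_sum_prod]
    refine Finset.prod_congr rfl fun k _ => ?_
    rw [monomial_pow]
  rw [h1, tweight, show ((Nat.multinomial s t : ℕ) : MvPolynomial σ ℝ) = C ((Nat.multinomial s t : ℕ) : ℝ) by
    rw [map_natCast], C_mul_monomial]

/-- `Nⁿ` expanded by types over the support of `N`. -/
theorem pow_eq_sum_types (N : MvPolynomial σ ℝ) (n : ℕ) :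
    N ^ n = ∑ t ∈ N.support.piAntidiag n, monomial (texp N.support t) (tweight N N.support t) := by
  conv_lhs => rw [N.as_sum]
  exact sum_monomial_pow_eq_sum_types N N.support n

/-- The coefficient of `X^e` in `Nⁿ` is the total weight of the types with exponent `e`. -/
theorem coeff_pow_eq_sum_types (N : MvPolynomial σ ℝ) (n : ℕ) (e : σ →₀ ℕ) :
    (N ^ n).coeff e = ∑ t ∈ (N.support.piAntidiag n).filter (fun t => texp N.support t = e), tweight N N.support t := by
  rw [pow_eq_sum_types, coeff_sum, Finset.sum_filter]
  refine Finset.sum_congr rfl fun t _ => ?_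
  rw [coeff_monomial]

/-! ## Non-negative coefficients -/

omit [DecidableEq σ] in
/-- The weight of a type is non-negative when the coefficients are. -/
theorem tweight_nonneg {N : MvPolynomial σ ℝ} (hN : ∀ m, 0 ≤ N.coeff m) (s : Finset (σ →₀ ℕ)) (t : (σ →₀ ℕ) → ℕ) :
    0 ≤ tweight N s t :=
  mul_nonneg (Nat.cast_nonneg _) (Finset.prod_nonneg fun k _ => pow_nonneg (hN k) _)

omit [DecidableEq σ] in
/-- The weight of a type supported in the support of `N` is POSITIVE (`c_k > 0` there). -/
theorem tweight_pos {N : MvPolynomial σ ℝ} (hN : ∀ m, 0 ≤ N.coeff m) (t : (σ →₀ ℕ) → ℕ) :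
    0 < tweight N N.support t := by
  refine mul_pos (by exact_mod_cast Nat.multinomial_pos N.support t) (Finset.prod_pos fun k hk => pow_pos ?_ _)
  exact lt_of_le_of_ne (hN k) (fun h => (mem_support_iff.1 hk) h.symm)

/-- **One type bounds the coefficient from below**: `tweight N s t ≤ coeff (texp t) (Nⁿ)` for `t ∈ piAntidiag (support N) n`. -/
theorem tweight_le_coeff_pow {N : MvPolynomial σ ℝ} (hN : ∀ m, 0 ≤ N.coeff m) {n : ℕ} {t : (σ →₀ ℕ) → ℕ}
    (ht : t ∈ N.support.piAntidiag n) : tweight N N.support t ≤ (N ^ n).coeff (texp N.support t) := by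
  rw [coeff_pow_eq_sum_types]
  exact Finset.single_le_sum (f := fun t => tweight N N.support t) (fun u _ => tweight_nonneg hN _ u)
    (Finset.mem_filter.2 ⟨ht, rfl⟩)

/-- Powers of a polynomial with non-negative coefficients have non-negative coefficients. -/
theorem coeff_pow_nonneg {N : MvPolynomial σ ℝ} (hN : ∀ m, 0 ≤ N.coeff m) (n : ℕ) (e : σ →₀ ℕ) : 0 ≤ (N ^ n).coeff e := by
  rw [coeff_pow_eq_sum_types]
  exact Finset.sum_nonneg fun t _ => tweight_nonneg hN _ t

omit [DecidableEq σ] in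
/-- **Super-multiplicativity of coefficients** for non-negative polynomials: `coeff e P · coeff e' Q ≤ coeff (e + e') (P·Q)`. -/
theorem coeff_mul_supermul {P Q : MvPolynomial σ ℝ} (hP : ∀ m, 0 ≤ P.coeff m) (hQ : ∀ m, 0 ≤ Q.coeff m) (e e' : σ →₀ ℕ) :
    P.coeff e * Q.coeff e' ≤ (P * Q).coeff (e + e') := by
  classical
  rw [coeff_mul]
  have hmem : (e, e') ∈ Finset.HasAntidiagonal.antidiagonal (e + e') := by
    rw [Finset.HasAntidiagonal.mem_antidiagonal]
  exact Finset.single_le_sum (f := fun x : (σ →₀ ℕ) × (σ →₀ ℕ) => P.coeff x.1 * Q.coeff x.2)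
    (fun x _ => mul_nonneg (hP x.1) (hQ x.2)) hmem

/-- `coeff e (Nⁿ) · coeff e' (Nᵐ) ≤ coeff (e + e') (Nⁿ⁺ᵐ)`. -/
theorem coeff_pow_supermul {N : MvPolynomial σ ℝ} (hN : ∀ m, 0 ≤ N.coeff m) (n m : ℕ) (e e' : σ →₀ ℕ) :
    (N ^ n).coeff e * (N ^ m).coeff e' ≤ (N ^ (n + m)).coeff (e + e') := by
  rw [pow_add]
  exact coeff_mul_supermul (coeff_pow_nonneg hN n) (coeff_pow_nonneg hN m) e e'

/-! ## The trivial upper bound `coeff e (Nⁿ) · gᵉ ≤ N(g)ⁿ` -/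

/-- The monomial value `gᵉ = ∏_i g_i^{e_i}`. -/
def monoVal (g : σ → ℝ) (e : σ →₀ ℕ) : ℝ := e.prod fun i k => g i ^ k

omit [DecidableEq σ] in
/-- `monoVal` is multiplicative in the exponent. -/
theorem monoVal_add (g : σ → ℝ) (e e' : σ →₀ ℕ) : monoVal g (e + e') = monoVal g e * monoVal g e' := by
  classical
  unfold monoVal
  exact Finsupp.prod_add_index' (fun i => pow_zero _) (fun i a b => pow_add _ _ _)

omit [DecidableEq σ] in
/-- `monoVal g (n • e) = (monoVal g e)ⁿ`. -/
theorem monoVal_nsmul (g : σ → ℝ) (n : ℕ) (e : σ →₀ ℕ) : monoVal g (n • e) = monoVal g e ^ n := by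
  induction n with
  | zero => simp [monoVal]
  | succ n ih => rw [succ_nsmul, monoVal_add, ih, pow_succ]

omit [DecidableEq σ] in
/-- For a polynomial with non-negative coefficients and `g ≥ 0`: ONE coefficient times its monomial value is at most the
value, `coeff e P · gᵉ ≤ P(g)`. -/
theorem coeff_mul_monoVal_le_eval {P : MvPolynomial σ ℝ} (hP : ∀ m, 0 ≤ P.coeff m) {g : σ → ℝ} (hg : ∀ i, 0 ≤ g i)
    (e : σ →₀ ℕ) : P.coeff e * monoVal g e ≤ eval g P := by
  classical
  rw [eval_eq]
  by_cases he : e ∈ P.support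
  · have : ∀ d ∈ P.support, 0 ≤ P.coeff d * ∏ i ∈ d.support, g i ^ d i :=
      fun d _ => mul_nonneg (hP d) (Finset.prod_nonneg fun i _ => pow_nonneg (hg i) _)
    refine le_trans (le_of_eq ?_) (Finset.single_le_sum this he)
    rfl
  · rw [notMem_support_iff.1 he, zero_mul]
    exact Finset.sum_nonneg fun d _ => mul_nonneg (hP d) (Finset.prod_nonneg fun i _ => pow_nonneg (hg i) _)

omit [DecidableEq σ] in
/-- **Upper bound**: `coeff e (Nⁿ) · gᵉ ≤ N(g)ⁿ` for `g ≥ 0`. -/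
theorem coeff_pow_mul_monoVal_le {N : MvPolynomial σ ℝ} (hN : ∀ m, 0 ≤ N.coeff m) {g : σ → ℝ} (hg : ∀ i, 0 ≤ g i)
    (n : ℕ) (e : σ →₀ ℕ) : (N ^ n).coeff e * monoVal g e ≤ eval g N ^ n := by
  classical
  rw [← map_pow]
  exact coeff_mul_monoVal_le_eval (coeff_pow_nonneg hN n) hg e

/-! ## Stirling: the entropy lower bound for multinomial coefficients -/

/-- Lower Stirling bound in the crude form `(n/e)ⁿ ≤ n!`. -/
theorem div_exp_pow_le_factorial (n : ℕ) : ((n : ℝ) / exp 1) ^ n ≤ (n.factorial : ℝ) := by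
  rcases Nat.eq_zero_or_pos n with rfl | hn
  · simp
  refine le_trans ?_ (Stirling.le_factorial_stirling n)
  have h1 : 1 ≤ Real.sqrt (2 * π * n) := by
    rw [Real.one_le_sqrt]
    have : (1 : ℝ) ≤ n := by exact_mod_cast hn
    nlinarith [Real.pi_gt_three]
  have h2 : 0 ≤ ((n : ℝ) / exp 1) ^ n := pow_nonneg (div_nonneg (Nat.cast_nonneg _) (exp_pos _).le) _
  nlinarith

/-- Upper Stirling bound in the crude form `t! ≤ e·√t·(t/e)ᵗ` for `t ≥ 1` (monotonicity of `stirlingSeq`). -/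
theorem factorial_le_stirling (t : ℕ) (ht : 1 ≤ t) :
    (t.factorial : ℝ) ≤ exp 1 * Real.sqrt t * ((t : ℝ) / exp 1) ^ t := by
  obtain ⟨m, rfl⟩ : ∃ m, t = m + 1 := ⟨t - 1, by omega⟩
  have hanti := Stirling.stirlingSeq'_antitone (Nat.zero_le m)
  simp only [Function.comp_apply, Nat.succ_eq_add_one, zero_add, Stirling.stirlingSeq_one] at hanti
  -- `stirlingSeq (m+1) = (m+1)! / (√(2(m+1)) ((m+1)/e)^(m+1)) ≤ e/√2`
  unfold Stirling.stirlingSeq at hanti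
  have hpos : 0 < Real.sqrt (2 * ((m + 1 : ℕ) : ℝ)) * ((((m + 1 : ℕ) : ℝ)) / exp 1) ^ (m + 1) := by positivity
  rw [div_le_iff₀ hpos] at hanti
  have hsq : Real.sqrt (2 * ((m + 1 : ℕ) : ℝ)) = Real.sqrt 2 * Real.sqrt ((m + 1 : ℕ) : ℝ) :=
    Real.sqrt_mul (by norm_num) _
  rw [hsq] at hanti
  have h2 : Real.sqrt 2 ≠ 0 := by positivity
  calc ((m + 1).factorial : ℝ) ≤ exp 1 / Real.sqrt 2 * (Real.sqrt 2 * Real.sqrt ((m + 1 : ℕ) : ℝ) *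
        ((((m + 1 : ℕ) : ℝ)) / exp 1) ^ (m + 1)) := hanti
    _ = exp 1 * Real.sqrt ((m + 1 : ℕ) : ℝ) * ((((m + 1 : ℕ) : ℝ)) / exp 1) ^ (m + 1) := by
        field_simp

/-- `log t! ≤ 1 + log t / 2 + t log t − t` for `t ≥ 1`. -/
theorem log_factorial_le (t : ℕ) (ht : 1 ≤ t) :
    Real.log t.factorial ≤ 1 + Real.log t / 2 + t * Real.log t - t := by
  have htpos : (0 : ℝ) < t := by exact_mod_cast ht
  have h := factorial_le_stirling t ht
  have hfpos : (0 : ℝ) < t.factorial := by exact_mod_cast Nat.factorial_pos t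
  have hrhs : 0 < exp 1 * Real.sqrt t * ((t : ℝ) / exp 1) ^ t := by positivity
  have hlog := Real.log_le_log hfpos h
  rw [Real.log_mul (by positivity) (by positivity), Real.log_mul (by positivity) (by positivity), Real.log_exp,
    Real.log_sqrt htpos.le, Real.log_pow, Real.log_div htpos.ne' (exp_pos 1).ne', Real.log_exp] at hlog
  linarith

/-- `n log n − n ≤ log n!`. -/
theorem log_factorial_ge (n : ℕ) : n * Real.log n - n ≤ Real.log n.factorial := by
  rcases Nat.eq_zero_or_pos n with rfl | hn
  · simp
  have hnpos : (0 : ℝ) < n := by exact_mod_cast hn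
  have h := div_exp_pow_le_factorial n
  have hl := Real.log_le_log (by positivity) h
  rw [Real.log_pow, Real.log_div hnpos.ne' (exp_pos 1).ne', Real.log_exp] at hl
  linarith

omit [DecidableEq σ] in
/-- **Entropy lower bound for multinomial coefficients** (method of types): for a type `t` on `s` with `n = Σ_{k∈s} t_k ≥ 1`,
`Σ_{k∈s} t_k·log(n/t_k) − |s|·(1 + log n / 2) ≤ log multinomial(s, t)`.  (Terms with `t_k = 0` vanish on the left:
`0·log(n/0) = 0`.) -/
theorem log_multinomial_ge (s : Finset (σ →₀ ℕ)) (t : (σ →₀ ℕ) → ℕ) (hn : 1 ≤ ∑ k ∈ s, t k) :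
    ∑ k ∈ s, (t k : ℝ) * Real.log ((∑ k ∈ s, t k : ℕ) / (t k : ℝ)) - s.card * (1 + Real.log (∑ k ∈ s, t k : ℕ) / 2)
      ≤ Real.log (Nat.multinomial s t) := by
  set n := ∑ k ∈ s, t k with hn_def
  have hnpos : (0 : ℝ) < n := by exact_mod_cast hn
  -- `log multinomial = log n! − Σ log t_k!`
  have hspec := Nat.multinomial_spec s t
  have hmul : Real.log (Nat.multinomial s t) = Real.log n.factorial - ∑ k ∈ s, Real.log (t k).factorial := by
    have h1 : ((∏ k ∈ s, (t k).factorial : ℕ) : ℝ) * (Nat.multinomial s t : ℝ) = (n.factorial : ℝ) := by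
      exact_mod_cast hspec
    have hprodpos : (0 : ℝ) < ((∏ k ∈ s, (t k).factorial : ℕ) : ℝ) := by
      exact_mod_cast Finset.prod_pos fun k _ => Nat.factorial_pos _
    have hmpos : (0 : ℝ) < (Nat.multinomial s t : ℝ) := by exact_mod_cast Nat.multinomial_pos s t
    have := congrArg Real.log h1
    rw [Real.log_mul hprodpos.ne' hmpos.ne', Nat.cast_prod, Real.log_prod (s := s) (fun k _ => by
      exact_mod_cast (Nat.factorial_pos (t k)).ne')] at this
    linarith
  -- each `log t_k! ≤ 1 + log n / 2 + t_k log t_k − t_k`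
  have hk : ∀ k ∈ s, Real.log (t k).factorial ≤ 1 + Real.log n / 2 + t k * Real.log (t k) - t k := by
    intro k hk
    rcases Nat.eq_zero_or_pos (t k) with h0 | hpos
    · rw [h0]; simp
      have : 0 ≤ Real.log n := Real.log_nonneg (by exact_mod_cast hn)
      linarith
    · have hle : (t k : ℝ) ≤ n := by exact_mod_cast Finset.single_le_sum (fun j _ => Nat.zero_le (t j)) hk
      have htk : (0 : ℝ) < t k := by exact_mod_cast hpos
      have := log_factorial_le (t k) hpos
      have hlogle : Real.log (t k) ≤ Real.log n := Real.log_le_log htk hle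
      linarith
  have hsum : ∑ k ∈ s, Real.log (t k).factorial ≤ ∑ k ∈ s, (1 + Real.log n / 2 + t k * Real.log (t k) - t k) :=
    Finset.sum_le_sum hk
  rw [Finset.sum_sub_distrib, Finset.sum_add_distrib, Finset.sum_const, nsmul_eq_mul] at hsum
  have hsumt : ∑ k ∈ s, (t k : ℝ) = n := by rw [hn_def]; push_cast; rfl
  rw [hsumt] at hsum
  -- rewrite the target's sum: `t_k log(n/t_k) = t_k log n − t_k log t_k`
  have hterm : ∀ k ∈ s, (t k : ℝ) * Real.log ((n : ℝ) / t k) = t k * Real.log n - t k * Real.log (t k) := by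
    intro k _
    rcases Nat.eq_zero_or_pos (t k) with h0 | hpos
    · rw [h0]; simp
    · rw [Real.log_div hnpos.ne' (by exact_mod_cast hpos.ne')]; ring
  rw [Finset.sum_congr rfl hterm, Finset.sum_sub_distrib, ← Finset.sum_mul, hsumt, hmul]
  have hfac := log_factorial_ge n
  linarith

end Summit.KontsevichZagierPeriods.Zeta5Search.Families.CTTypes
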